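import Literature.Barriers.ValiantsHypothesis.ShiftedPartialsCaseC1
import Literature.Barriers.ValiantsHypothesis.ShiftedPartialsCaseC2
import Literature.Barriers.ValiantsHypothesis.ShiftedPartialsCaseC3
import Literature.Barriers.ValiantsHypothesis.ShiftedPartialsCaseC4
import Literature.RingTheory.MvPolynomial.MacaulayBound
import Literature.RingTheory.MvPolynomial.MacaulayBoundProofs
import HarnessLib

/-!
# Shifted partial derivatives cannot separate the permanent from the determinant — the proof

Discharge, up to Macaulay's theorem, of the named fact `ShiftedPartialsCannotSeparate`
(`ShiftedPartialDerivatives.lean`; Efremenko–Landsberg–Schenck–Weyman, Math. Comp. 87 (2018),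
Thm. 1.5): `shiftedPartialsCannotSeparate_of_macaulay (hMac : MacaulayGrowthBound) :
ShiftedPartialsCannotSeparate`, with `M = 12`. (A sibling file rather than an append: the support
files import `ShiftedPartialDerivatives.lean`.)

The unconditional discharge `ShiftedPartialsCannotSeparate_holds` (appended below) feeds it
`MacaulayGrowthBound_holds` (`Literature/RingTheory/MvPolynomial/MacaulayBoundProofs.lean`:
Macaulay's theorem on lex segments after Miller–Sturmfels §2.4, with a compression argument, and a
leading-monomial reduction). In `shiftedPartialsCannotSeparate_of_macaulay` the hypothesis is the named fact
`Literature.RingTheory.MvPolynomial.MacaulayGrowthBound` (Macaulay 1927 / ELSW Cor. 2.4: an ideal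
generated in degree `d - q` by at least `dim S^{d-q}ℂ^N` independent forms has at least
`dim S^{d-q+τ}ℂ^N` forms in every higher degree), used exactly once, in Case C2, as in print ("The
assumption ... Corollary 2.4 applies", §4). Everything else of the printed proof is proved in the tree:

* `caseC1` (`ShiftedPartialsCaseC1.lean`, any field): `(m+2)(n-k) ≤ n` — a block degeneration of
  `det_n` replacing the printed `R = ℓ^r det_m(Y)^s` (whose containment `V_R ⊇ S^s[ℓ, y]` the paper
  asserts without proof);
* `caseC2` (`ShiftedPartialsCaseC2.lean`, any field, given Macaulay's bound): `3m ≤ 2k`, `k + 2m ≤ n + 1`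
  — `rank < dim S^{m+τ}ℂ^{n²} ≤ rank(det side)` via `binom(n²+m-1, m) ≤ binom(n,k)²` (Stirling);
* `caseC3` (`ShiftedPartialsCaseC3.lean`, char. 0): `2k < 3m`, `3n²m ≤ 2τ` — the two-power
  degeneration `x₁₁^n ± x₂₂^n ∈ End·det_n` (the paper's `ℓ₁^n + ℓ₂^n`);
* `caseC4` (`ShiftedPartialsCaseC4.lean`, any field): `2k < 3m`, `2τ ≤ 3n²m` — the proved
  Gupta–Kamath–Kayal–Saptharishi bound (`gkks_bound`, `ShiftedPartialsGKKS.lean`) against the crude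
  bound / `dim S^{m+τ}`.

Coverage for `m > 12`, `n > 2m² + 2m`, `1 ≤ k < n` (this replaces the printed thresholds
`n - √n·m`, `2√n·m`, `n³`, `6n³/m`, `n³/(6m)`, which do not cover `2m²+2m < n ≲ 27m²`): if
`(m+2)(n-k) ≤ n` use C1; otherwise `n - k ≥ 2m - 1` (as `(m+2)(2m-2) < n`), i.e. `k + 2m ≤ n + 1`, and
if `3m ≤ 2k` use C2; otherwise `2k < 3m` and C3 or C4 according to `τ`. In particular the range
`n - k = 2m - 1` left open by `caseC1` (its docstring's `s < 2m` remark notwithstanding) is covered by C2.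

## References

* [EfremenkoLandsbergSchenckWeyman2018] K. Efremenko, J. M. Landsberg, H. Schenck, J. Weyman, *The
  method of shifted partial derivatives cannot separate the permanent from the determinant*, Math.
  Comp. 87 (2018), 2037–2045, Thm. 1.5 and §§3–6.
* [BrunsHerzog1998] W. Bruns, J. Herzog, *Cohen–Macaulay rings*, Thm. 4.2.10 (Macaulay).
-/

namespace Literature.Barriers.ValiantsHypothesis

open Literature.Computability.AlgebraicComplexity

/-- **ELSW Theorem 1.5, proved up to Macaulay's theorem**: given Macaulay's growth bound
(`MacaulayGrowthBound`, a named fact), there is `M` (`= 12`) such that for `m > M`, `n > 2m² + 2m`,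
every `τ` and every `1 ≤ k < n`, `rank((X₀₀^{n-m}per_m)_{(k,n-k)[τ]}) < rank((det_n)_{(k,n-k)[τ]})`.
The four cases are `caseC1`–`caseC4` of the support files; the dispatch is by `(m+2)(n-k) ≤ n`,
then `3m ≤ 2k`, then `3n²m ≤ 2τ`.
[cite: EfremenkoLandsbergSchenckWeyman2018, Thm. 1.5 (§§3–6)] -/
theorem shiftedPartialsCannotSeparate_of_macaulay
    (hMac : Literature.RingTheory.MvPolynomial.MacaulayGrowthBound) : ShiftedPartialsCannotSeparate := by
  refine ⟨12, fun m hm n _ hn τ k hk0 hkn => ?_⟩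
  by_cases h1 : (m + 2) * (n - k) ≤ n
  · exact caseC1 (K := ℂ) (by omega) (by nlinarith) k τ hkn h1
  have hk2m : k + 2 * m ≤ n + 1 := by
    by_contra h
    apply h1
    have hs : n - k + 2 ≤ 2 * m := by omega
    have h' : (m + 2) * (n - k + 2) ≤ (m + 2) * (2 * m) := Nat.mul_le_mul_left _ hs
    nlinarith [h', hn]
  by_cases h2 : 3 * m ≤ 2 * k
  · exact caseC2 hMac ℂ (by omega) hn k τ h2 hk2m
  push Not at h2
  by_cases h3 : 3 * n ^ 2 * m ≤ 2 * τ
  · exact caseC3 (K := ℂ) (by omega) hn k τ hk0 h2 h3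
  · exact caseC4 ℂ (by omega) hn k τ hk0 h2 (by omega)

/-- **ELSW Theorem 1.5 (discharge of the named fact `ShiftedPartialsCannotSeparate`)**: there is `M`
(`= 12`) such that for all `m > M`, `n > 2m² + 2m`, every `τ` and every `1 ≤ k < n`,
`rank((X₀₀^{n-m}per_m)_{(k,n-k)[τ]}) < rank((det_n)_{(k,n-k)[τ]})` — unconditional:
`shiftedPartialsCannotSeparate_of_macaulay` fed with the proved Macaulay growth bound
`MacaulayGrowthBound_holds`. [cite: EfremenkoLandsbergSchenckWeyman2018, Thm. 1.5] -/
theorem ShiftedPartialsCannotSeparate_holds : ShiftedPartialsCannotSeparate :=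
  shiftedPartialsCannotSeparate_of_macaulay Literature.RingTheory.MvPolynomial.MacaulayGrowthBound_holds

end Literature.Barriers.ValiantsHypothesis
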